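import Literature.Analysis.FluidPDE.HolderExtraction
import Literature.Analysis.FluidPDE.OseenMildHolder
import Literature.Analysis.FluidPDE.OseenDuhamelLimits
import Literature.Analysis.FluidPDE.WholeSpaceIBP
import HarnessLib

/-!
# KNSS 2009, Lemma 6.1: compactness of bounded Oseen-mild fields on growing slabs (symmetry-free)

Analysis/FluidPDE proof file (theorems only; no definitions, no named facts).

Koch–Nadirashvili–Seregin–Šverák, *Liouville theorems for the Navier–Stokes equations and
applications*, Acta Math. 203 (2009) 83–105 = arXiv:0709.3599, Lemma 6.1, p. 11: "Assume that
`u_l` is a sequence of bounded mild solutions of Navier–Stokes defined in `ℝⁿ × (T_l, 0)` (for some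
initial data) with a uniform bound `|u_l| ≤ C`, and `T_l ↘ −∞`. Then we can choose a subsequence
such that along the subsequence the `u_l` converge locally uniformly in `ℝⁿ × (−∞, 0)` to an ancient
mild solution `u` satisfying `|u| ≤ C`", "an easy consequence of the results in Section 4"; and its
Type-I-rate form used in the proof of Theorem 6.2, p. 13 ("in view of bound (wkbound3) we can
choose a subsequence … such that the `w⁽ᵏ⁾` converge uniformly on compact subsets of
`ℝ³ × (−∞, 0)` to an ancient mild solution `w`").

The tree already proves the Type-I-rate form as the discharge
`KNSS2009_typeI_rate_mildCompactness_holds` (`KNSSTypeIRateMildCompactnessProofs.lean`) of the named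
fact `KNSS2009_typeI_rate_mildCompactness` (`KNSSTypeIRateMild.lean`), but that fact carries the
baggage of its use in the proof of Theorem 6.2: the fields are CLASSICAL solutions on
`(A_k, B_k)`, `B_k > 0`, and the unused axisymmetric hypotheses (wkbound2), `M_k → ∞`, `K > 0`.
Its proof uses only (steps 1–5 of that file's module docstring): continuity of each field on its
open slab, weakly divergence-free slices, a bound which is uniform on every `(−∞, −δ]`, and the Oseen
integral identity `w(t) = e^{(t−s)Δ}w(s) − B¹_s(w, w)(t)` between all pairs of negative times of the
slab. This file states and proves exactly that, in three forms:

* `exists_oseenMild_limit_of_monotone_bound` — the engine: fields `w_k` continuous on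
  `(A_k, 0) × E`, `A_k → −∞`, weakly divergence-free slices, the Oseen identity for
  `A_k < s < t < 0`, and a bound `‖w_k(τ, x)‖ ≤ β(τ)` by a profile `β` monotone on `(−∞, 0)`; then a
  subsequence converges, uniformly on the compact slab pieces `[−(n+2), −1/(n+2)] × B̄(0, n+2)`
  (hence pointwise on the open slab and locally uniformly on every negative time slice), to a field
  `W` continuous on the open slab, with weakly divergence-free slices, `‖W(t, x)‖ ≤ β(t)`, and the
  Oseen identity for all `s < t < 0`;
* `KNSS2009_lemma61_oseenMild` — Lemma 6.1 as printed (constant bound `C`);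
* `KNSS2009_lemma61_typeI_rate` — the Type-I-rate form `√(−τ)‖w_k‖ ≤ C` ⟹ `√(−t)‖W‖ ≤ C`
  (the form of `KNSS2009_typeI_rate_mildCompactness`, without the classical/axisymmetric baggage).

The proof is that of `KNSS2009_typeI_rate_mildCompactness_holds`, verbatim up to the bookkeeping of
the bound: the uniform `1/4`-Hölder modulus of bounded solutions of the Oseen equation on the slab
pieces (`exists_holder_quarter_of_oseenMild`), the diagonal Arzelà–Ascoli extraction
(`exists_strictMono_tendstoUniformlyOn_of_bound`), and dominated convergence in the divergence
condition and in the Oseen identity (`tendsto_heatExtension_of_tendsto_of_bound`,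
`tendsto_oseenDuhamel_of_tendsto_of_bound`). Physical space is any finite-dimensional real inner
product space `E` (KNSS: `ℝⁿ`). "Mild" is rendered, as everywhere in the tree's KNSS files, by the
Oseen integral identity restarted at every time (`NSBoundedMildOseen`: `heatExtension`,
`oseenDuhamel`; KNSS §4 (i) and Remark 4.1).

## References

* G. Koch, N. Nadirashvili, G. Seregin, V. Šverák, *Liouville theorems for the Navier–Stokes
  equations and applications*, Acta Math. 203 (2009) 83–105 = arXiv:0709.3599: Lemma 4.1 (p. 8),
  Lemma 6.1 (p. 11), proof of Thm. 6.2 (p. 13). [KochNadirashviliSereginSverak2009]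
-/

noncomputable section

open MeasureTheory Set Function Filter TopologicalSpace Metric
open _root_.Topology
open scoped RealInnerProductSpace NNReal ENNReal

namespace Literature.Analysis.FluidPDE

variable {E : Type*} [NormedAddCommGroup E] [InnerProductSpace ℝ E] [FiniteDimensional ℝ E]
  [MeasurableSpace E] [BorelSpace E]

/-- **KNSS 2009, Lemma 6.1, symmetry-free engine with a monotone bound profile.** Let
`w_k : ℝ → E → E` be continuous on the open slabs `(A_k, 0) × E` with `A_k → −∞`, with weakly
divergence-free slices, satisfying the Oseen integral identity
`w_k(t) = e^{(t−s)Δ}w_k(s) − B¹_s(w_k, w_k)(t)` pointwise for all `A_k < s < t < 0`, and the bound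
`‖w_k(τ, x)‖ ≤ β(τ)` for `A_k < τ < 0` by a profile `β` monotone on `(−∞, 0)` (constant: Lemma 6.1
as printed; `C/√(−τ)`: the form used in the proof of Theorem 6.2). Then there are a subsequence `φ`
and a field `W`, continuous on `(−∞, 0) × E`, with weakly divergence-free slices, `‖W(t, x)‖ ≤ β(t)`,
satisfying the Oseen identity for all `s < t < 0`, such that `w_{φ(j)} → W` uniformly on every slab
piece `[−(n+2), −1/(n+2)] × B̄(0, n+2)`, pointwise at every point of the open slab, and locally
uniformly on every negative time slice (KNSS 2009, Lemma 6.1, "an easy consequence of the results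
in Section 4": here the uniform `1/4`-Hölder modulus of bounded Oseen-mild fields, a diagonal
Arzelà–Ascoli extraction, and dominated convergence in the two identities). [cite: KochNadirashviliSereginSverak2009, Lemma 6.1 (arXiv p. 11) and proof of Thm 6.2 (p. 13)] -/
theorem exists_oseenMild_limit_of_monotone_bound {A : ℕ → ℝ} {w : ℕ → ℝ → E → E} {β : ℝ → ℝ}
    (hAlim : Tendsto A atTop atBot) (hβ : MonotoneOn β (Iio 0))
    (hcont : ∀ k, ContinuousOn (uncurry (w k)) (Ioo (A k) 0 ×ˢ univ))
    (hdiv : ∀ k, ∀ t ∈ Ioo (A k) 0, IsWeaklyDivFree (w k t))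
    (hmild : ∀ k, ∀ s t : ℝ, A k < s → s < t → t < 0 → ∀ x,
      w k t x = UnboundedOperators.heatExtension (w k s) (t - s) x -
        oseenDuhamel 1 s (w k) (w k) t x)
    (hbdd : ∀ k, ∀ τ ∈ Ioo (A k) 0, ∀ x, ‖w k τ x‖ ≤ β τ) :
    ∃ (φ : ℕ → ℕ) (W : ℝ → E → E), StrictMono φ ∧
      ContinuousOn (uncurry W) (Iio 0 ×ˢ univ) ∧
      (∀ t < 0, IsWeaklyDivFree (W t)) ∧
      (∀ t < 0, ∀ x, ‖W t x‖ ≤ β t) ∧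
      (∀ s t : ℝ, s < t → t < 0 → ∀ x,
        W t x = UnboundedOperators.heatExtension (W s) (t - s) x - oseenDuhamel 1 s W W t x) ∧
      (∀ n : ℕ, TendstoUniformlyOn (fun j => uncurry (w (φ j))) (uncurry W) atTop
        (Icc (-((n : ℝ) + 2)) (-(1 / ((n : ℝ) + 2))) ×ˢ closedBall (0 : E) ((n : ℝ) + 2))) ∧
      (∀ t < 0, ∀ x, Tendsto (fun j => w (φ j) t x) atTop (𝓝 (W t x))) ∧
      (∀ t < 0, TendstoLocallyUniformly (fun j => w (φ j) t) (W t) atTop) := by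
  -- ## Step 1: per-`k` facts
  have hslice : ∀ k, ∀ t ∈ Ioo (A k) 0, Continuous (w k t) := fun k t ht =>
    (hcont k).comp_continuous (Continuous.prodMk_right t) fun x => ⟨ht, mem_univ x⟩
  -- monotonicity of the profile: `β τ ≤ β (-δ)` for `τ ≤ -δ < 0`
  have hβle : ∀ {δ τ : ℝ}, 0 < δ → τ ≤ -δ → β τ ≤ β (-δ) := fun {δ τ} hδ hτ =>
    hβ (show τ ∈ Iio 0 from mem_Iio.2 (by linarith)) (show -δ ∈ Iio 0 from mem_Iio.2 (by linarith))
      hτ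
  -- eventually the slice lies in the domain
  have hdomA : ∀ t : ℝ, ∀ᶠ k in atTop, A k < t := fun t => hAlim.eventually (eventually_lt_atBot t)
  -- nonnegativity of the profile at negative times (the domains are eventually nonempty)
  have hβ0 : ∀ τ < 0, 0 ≤ β τ := fun τ hτ => by
    obtain ⟨k, hk⟩ := (hdomA τ).exists
    exact (norm_nonneg _).trans (hbdd k τ ⟨hk, hτ⟩ 0)
  -- ## Step 2: the uniform Hölder modulus on the slab pieces
  obtain ⟨K₀, hK₀, hHold⟩ := exists_holder_quarter_of_oseenMild (E := E)
  -- bound and modulus constant on the `n`-th piece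
  set R : ℕ → ℝ := fun n => β (-(1 / ((n : ℝ) + 2))) with hR
  have hR0 : ∀ n, 0 ≤ R n := fun n => hβ0 _ (by rw [neg_lt_zero]; positivity)
  set V : ℕ → ℝ × E → E := fun k z => w k z.1 z.2 with hV
  -- the slab pieces `[−(n+2), −1/(n+2)] × B̄(0, n+2)` of `HolderExtraction.lean`
  set T : ℕ → Set (ℝ × E) := fun n =>
    Icc (-((n : ℝ) + 2)) (-(1 / ((n : ℝ) + 2))) ×ˢ closedBall (0 : E) ((n : ℝ) + 2) with hT
  have hVn : ∀ n : ℕ, ∀ᶠ k in atTop, ContinuousOn (V k) (T n) ∧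
      (∀ z ∈ T n, ‖V k z‖ ≤ R n) ∧
      ∀ z ∈ T n, ∀ z' ∈ T n,
        dist (V k z) (V k z') ≤ K₀ * (R n + R n ^ 2) * dist z z' ^ (1 / 4 : ℝ) := by
    intro n
    have hn2 : (0 : ℝ) < (n : ℝ) + 2 := by positivity
    have hδ : (0 : ℝ) < 1 / ((n : ℝ) + 2) := by positivity
    filter_upwards [hdomA (-((n : ℝ) + 3))] with k hk
    -- the window `[a, b] = [−(n+3), −1/(n+2)] ⊂ (A k, 0)`
    set a : ℝ := -((n : ℝ) + 3) with ha
    set b : ℝ := -(1 / ((n : ℝ) + 2)) with hb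
    have hb0 : b < 0 := by rw [hb]; linarith
    have hIcc0 : ∀ t ∈ Icc a b, t ∈ Ioo (A k) 0 := fun t ht =>
      ⟨hk.trans_le ht.1, ht.2.trans_lt hb0⟩
    have hbR : ∀ t ∈ Icc a b, ∀ x, ‖w k t x‖ ≤ R n := fun t ht x =>
      (hbdd k t (hIcc0 t ht) x).trans (hβle hδ (by rw [hb] at ht; exact ht.2))
    have hmod := hHold (hR0 n) (fun t ht => hslice k t (hIcc0 t ht)) hbR
      (fun s t has hst htb x => hmild k s t (hk.trans_le has) hst (htb.trans_lt hb0) x)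
    have hpiece : ∀ z ∈ T n, z.1 ∈ Icc (a + 1) b := fun z hz => by
      obtain ⟨⟨h1, h2⟩, -⟩ := mem_slabPiece.1 hz
      exact ⟨by rw [ha]; linarith, by rw [hb]; exact h2⟩
    refine ⟨?_, fun z hz => ?_, fun z hz z' hz' => ?_⟩
    · refine (hcont k).mono fun z hz => ⟨?_, mem_univ _⟩
      have h := hpiece z hz
      exact hIcc0 z.1 ⟨by linarith [h.1], h.2⟩
    · have h := hpiece z hz
      exact hbR z.1 ⟨by linarith [h.1], h.2⟩ z.2
    · have h := hmod z'.1 (hpiece z' hz') z.1 (hpiece z hz) z'.2 z.2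
      rw [dist_eq_norm, Prod.dist_eq, Real.dist_eq, dist_eq_norm]
      exact h
  -- ## Step 3: extraction
  obtain ⟨φ, hφ, W₀, hW₀⟩ := exists_strictMono_tendstoUniformlyOn_of_bound
    (fun n => isCompact_slabPiece (E := E) n)
    (fun n => mul_nonneg hK₀.le (add_nonneg (hR0 n) (sq_nonneg _))) (fun _ => by norm_num) hVn
  have hφt : Tendsto φ atTop atTop := hφ.tendsto_atTop
  set W : ℝ → E → E := fun t x => W₀ (t, x) with hWdef
  have hVφ : ∀ n, ∀ᶠ j in atTop, ContinuousOn (V (φ j)) (T n) := fun n =>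
    (hφt.eventually (hVn n)).mono fun j hj => hj.1
  -- continuity of the limit on the open slab
  have hWc : ContinuousOn (uncurry W) (Iio 0 ×ˢ univ) := by
    have h := continuousOn_slab_of_tendstoUniformlyOn hVφ hW₀
    exact h.congr fun z _ => rfl
  -- pointwise convergence at negative times
  have hpt : ∀ t < 0, ∀ x, Tendsto (fun j => w (φ j) t x) atTop (𝓝 (W t x)) := fun t ht x =>
    tendsto_of_tendstoUniformlyOn_slabPiece hW₀ ht x
  -- eventually the slice lies in the domain
  have hdom : ∀ t : ℝ, ∀ᶠ j in atTop, A (φ j) < t := fun t =>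
    (hAlim.comp hφt).eventually (eventually_lt_atBot t)
  refine ⟨φ, W, hφ, hWc, fun t ht => ?_, fun t ht x => ?_, fun s t hst ht x => ?_, ?_, hpt,
    fun t ht => ?_⟩
  · -- ## Step 4a: weak divergence-freeness of the limit slices
    intro θ hθ
    have hθ1 : ContDiff ℝ 1 θ := contDiff_infty.1 hθ.contDiff 1
    have hgc : HasCompactSupport (gradient θ) := by
      have : gradient θ = (fun L => (InnerProductSpace.toDual ℝ E).symm L) ∘ fderiv ℝ θ := rfl
      rw [this]
      exact (hθ.hasCompactSupport.fderiv (𝕜 := ℝ)).comp_left (by simp)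
    set Mt : ℝ := β t with hMt
    have hθi : Integrable (fun x => Mt * ‖gradient θ x‖) volume :=
      (((continuous_gradient_of_contDiff hθ1).integrable_of_hasCompactSupport hgc).norm).const_mul Mt
    have hlimθ : Tendsto (fun j => ∫ x, ⟪w (φ j) t x, gradient θ x⟫) atTop
        (𝓝 (∫ x, ⟪W t x, gradient θ x⟫)) := by
      refine tendsto_integral_filter_of_dominated_convergence (fun x => Mt * ‖gradient θ x‖)
        ?_ ?_ hθi (Eventually.of_forall fun x => (hpt t ht x).inner tendsto_const_nhds)
      · filter_upwards [hdom t] with j hj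
        exact ((hslice (φ j) t ⟨hj, ht⟩).inner
          (continuous_gradient_of_contDiff hθ1)).aestronglyMeasurable
      · filter_upwards [hdom t] with j hj
        exact Eventually.of_forall fun x => (norm_inner_le_norm _ _).trans
          (mul_le_mul_of_nonneg_right (hbdd (φ j) t ⟨hj, ht⟩ x) (norm_nonneg _))
    have hzero : ∀ᶠ j in atTop, ∫ x, ⟪w (φ j) t x, gradient θ x⟫ = 0 := by
      filter_upwards [hdom t] with j hj
      exact hdiv (φ j) t ⟨hj, ht⟩ θ hθ
    exact tendsto_nhds_unique hlimθ (tendsto_const_nhds.congr' (hzero.mono fun j hj => hj.symm))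
  · -- ## Step 4b: the bound `‖W‖ ≤ β`
    refine le_of_tendsto (hpt t ht x).norm ?_
    filter_upwards [hdom t] with j hj
    exact hbdd (φ j) t ⟨hj, ht⟩ x
  · -- ## Step 5: the Oseen identity in the limit
    have hs0 : s < 0 := hst.trans ht
    obtain ⟨k₀, hk₀⟩ := eventually_atTop.1 (hdom s)
    set u : ℕ → ℝ → E → E := fun j => w (φ (j + k₀)) with hu
    have hAu : ∀ j, A (φ (j + k₀)) < s := fun j => hk₀ _ (Nat.le_add_left _ _)
    have hshift : Tendsto (fun j => j + k₀) atTop atTop := tendsto_add_atTop_nat k₀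
    -- bound on `(s, t)`
    set M₀ : ℝ := β t with hM₀
    have hM₀0 : 0 ≤ M₀ := hβ0 t ht
    have huM : ∀ j, ∀ τ ∈ Ioo s t, ∀ y, ‖u j τ y‖ ≤ M₀ := fun j τ hτ y =>
      (hbdd _ τ ⟨(hAu j).trans hτ.1, hτ.2.trans ht⟩ y).trans
        (hβ (show τ ∈ Iio 0 from hτ.2.trans ht) (show t ∈ Iio 0 from ht) hτ.2.le)
    -- measurability
    have hum : ∀ j, AEStronglyMeasurable (uncurry (u j))
        ((volume : Measure (ℝ × E)).restrict (Ioo s t ×ˢ univ)) :=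
      fun j => ((hcont _).mono (prod_mono
        (fun τ hτ => ⟨(hAu j).trans hτ.1, hτ.2.trans ht⟩) Subset.rfl)).aestronglyMeasurable
          (measurableSet_Ioo.prod MeasurableSet.univ)
    have hWm : AEStronglyMeasurable (uncurry W)
        ((volume : Measure (ℝ × E)).restrict (Ioo s t ×ˢ univ)) :=
      (hWc.mono (prod_mono (fun τ hτ => hτ.2.trans ht) Subset.rfl)).aestronglyMeasurable
        (measurableSet_Ioo.prod MeasurableSet.univ)
    -- pointwise convergence along the shifted subsequence
    have hptu : ∀ τ < 0, ∀ y, Tendsto (fun j => u j τ y) atTop (𝓝 (W τ y)) := fun τ hτ y =>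
      (hpt τ hτ y).comp hshift
    -- the Duhamel term
    have hD : Tendsto (fun j => oseenDuhamel 1 s (u j) (u j) t x) atTop
        (𝓝 (oseenDuhamel 1 s W W t x)) :=
      tendsto_oseenDuhamel_of_tendsto_of_bound one_pos hM₀0 hst hum hWm huM
        (fun τ hτ y => hptu τ (hτ.2.trans ht) y) x
    -- the caloric term
    have hH : Tendsto (fun j => UnboundedOperators.heatExtension (u j s) (t - s) x) atTop
        (𝓝 (UnboundedOperators.heatExtension (W s) (t - s) x)) := by
      refine tendsto_heatExtension_of_tendsto_of_bound (M := β s)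
        (fun j => (hslice _ s ⟨hAu j, hs0⟩).aestronglyMeasurable)
        (fun j z => hbdd _ s ⟨hAu j, hs0⟩ z) (hptu s hs0) (sub_pos.2 hst) x
    -- the identity for each `j` and the limit
    have hid : (fun j => u j t x) = fun j =>
        UnboundedOperators.heatExtension (u j s) (t - s) x - oseenDuhamel 1 s (u j) (u j) t x :=
      funext fun j => hmild _ s t (hAu j) hst ht x
    have hlim2 : Tendsto (fun j => u j t x) atTop
        (𝓝 (UnboundedOperators.heatExtension (W s) (t - s) x - oseenDuhamel 1 s W W t x)) := by
      rw [hid]; exact hH.sub hD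
    exact tendsto_nhds_unique (hptu t ht x) hlim2
  · -- ## Step 3': uniform convergence on the pieces (the statement of the extraction)
    intro n
    exact (hW₀ n).congr (Eventually.of_forall fun j => eqOn_refl _ _)
  · -- ## Step 3'': slice-wise locally uniform convergence
    exact tendstoLocallyUniformly_slice_of_tendstoUniformlyOn_slabPiece hW₀ ht

/-- **KNSS 2009, Lemma 6.1, as printed** (symmetry-free, any finite-dimensional `E`): bounded
Oseen-mild fields `u_l` on `ℝⁿ × (T_l, 0)` with a uniform bound `|u_l| ≤ C` and `T_l → −∞` —
continuous on their open slabs, with weakly divergence-free slices, satisfying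
`u_l(t) = e^{(t−s)Δ}u_l(s) − B¹_s(u_l, u_l)(t)` for all `T_l < s < t < 0` — have a subsequence
converging locally uniformly in `ℝⁿ × (−∞, 0)` (uniformly on the compact slab pieces, pointwise,
and locally uniformly on every negative slice) to an ancient Oseen-mild field `u` with `|u| ≤ C`:
continuous on the open slab, weakly divergence-free slices, the Oseen identity for all `s < t < 0`.
[cite: KochNadirashviliSereginSverak2009, Lemma 6.1 (arXiv p. 11)] -/
theorem KNSS2009_lemma61_oseenMild {A : ℕ → ℝ} {w : ℕ → ℝ → E → E} {C : ℝ}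
    (hAlim : Tendsto A atTop atBot)
    (hcont : ∀ k, ContinuousOn (uncurry (w k)) (Ioo (A k) 0 ×ˢ univ))
    (hdiv : ∀ k, ∀ t ∈ Ioo (A k) 0, IsWeaklyDivFree (w k t))
    (hmild : ∀ k, ∀ s t : ℝ, A k < s → s < t → t < 0 → ∀ x,
      w k t x = UnboundedOperators.heatExtension (w k s) (t - s) x -
        oseenDuhamel 1 s (w k) (w k) t x)
    (hbdd : ∀ k, ∀ τ ∈ Ioo (A k) 0, ∀ x, ‖w k τ x‖ ≤ C) :
    ∃ (φ : ℕ → ℕ) (W : ℝ → E → E), StrictMono φ ∧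
      ContinuousOn (uncurry W) (Iio 0 ×ˢ univ) ∧
      (∀ t < 0, IsWeaklyDivFree (W t)) ∧
      (∀ t < 0, ∀ x, ‖W t x‖ ≤ C) ∧
      (∀ s t : ℝ, s < t → t < 0 → ∀ x,
        W t x = UnboundedOperators.heatExtension (W s) (t - s) x - oseenDuhamel 1 s W W t x) ∧
      (∀ n : ℕ, TendstoUniformlyOn (fun j => uncurry (w (φ j))) (uncurry W) atTop
        (Icc (-((n : ℝ) + 2)) (-(1 / ((n : ℝ) + 2))) ×ˢ closedBall (0 : E) ((n : ℝ) + 2))) ∧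
      (∀ t < 0, ∀ x, Tendsto (fun j => w (φ j) t x) atTop (𝓝 (W t x))) ∧
      (∀ t < 0, TendstoLocallyUniformly (fun j => w (φ j) t) (W t) atTop) :=
  exists_oseenMild_limit_of_monotone_bound (β := fun _ => C) hAlim monotoneOn_const hcont hdiv
    hmild hbdd

/-- **KNSS 2009, Lemma 6.1 in the Type-I-rate form of the proof of Theorem 6.2** (symmetry-free;
this is the named fact `KNSS2009_typeI_rate_mildCompactness` stripped of its classical and
axisymmetric baggage): Oseen-mild fields `w_k` continuous on `(A_k, 0) × E`, `A_k → −∞`, with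
weakly divergence-free slices and the rate `√(−τ)‖w_k(τ, x)‖ ≤ C` for `A_k < τ < 0`, have a
subsequence converging (uniformly on the slab pieces, pointwise on the open slab, locally uniformly
on every negative slice) to a field `W` continuous on `(−∞, 0) × E` with weakly divergence-free
slices, `√(−t)‖W(t, x)‖ ≤ C`, and `W(t) = e^{(t−s)Δ}W(s) − B¹_s(W, W)(t)` for all `s < t < 0`.
[cite: KochNadirashviliSereginSverak2009, Lemma 6.1 (arXiv p. 11) and proof of Thm 6.2 (p. 13)] -/
theorem KNSS2009_lemma61_typeI_rate {A : ℕ → ℝ} {w : ℕ → ℝ → E → E} {C : ℝ}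
    (hAlim : Tendsto A atTop atBot)
    (hcont : ∀ k, ContinuousOn (uncurry (w k)) (Ioo (A k) 0 ×ˢ univ))
    (hdiv : ∀ k, ∀ t ∈ Ioo (A k) 0, IsWeaklyDivFree (w k t))
    (hmild : ∀ k, ∀ s t : ℝ, A k < s → s < t → t < 0 → ∀ x,
      w k t x = UnboundedOperators.heatExtension (w k s) (t - s) x -
        oseenDuhamel 1 s (w k) (w k) t x)
    (hI : ∀ k, ∀ τ ∈ Ioo (A k) 0, ∀ x, Real.sqrt (-τ) * ‖w k τ x‖ ≤ C) :
    ∃ (φ : ℕ → ℕ) (W : ℝ → E → E), StrictMono φ ∧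
      ContinuousOn (uncurry W) (Iio 0 ×ˢ univ) ∧
      (∀ t < 0, IsWeaklyDivFree (W t)) ∧
      (∀ t < 0, ∀ x, Real.sqrt (-t) * ‖W t x‖ ≤ C) ∧
      (∀ s t : ℝ, s < t → t < 0 → ∀ x,
        W t x = UnboundedOperators.heatExtension (W s) (t - s) x - oseenDuhamel 1 s W W t x) ∧
      (∀ n : ℕ, TendstoUniformlyOn (fun j => uncurry (w (φ j))) (uncurry W) atTop
        (Icc (-((n : ℝ) + 2)) (-(1 / ((n : ℝ) + 2))) ×ˢ closedBall (0 : E) ((n : ℝ) + 2))) ∧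
      (∀ t < 0, ∀ x, Tendsto (fun j => w (φ j) t x) atTop (𝓝 (W t x))) ∧
      (∀ t < 0, TendstoLocallyUniformly (fun j => w (φ j) t) (W t) atTop) := by
  -- `C ≥ 0` (the domains are eventually nonempty)
  have hC : 0 ≤ C := by
    obtain ⟨k, hk⟩ := (hAlim.eventually (eventually_lt_atBot (-1))).exists
    exact (mul_nonneg (Real.sqrt_nonneg _) (norm_nonneg _)).trans (hI k (-1) ⟨hk, by norm_num⟩ 0)
  -- the profile `β τ = C/√(−τ)` is monotone on `(−∞, 0)`
  set β : ℝ → ℝ := fun τ => C / Real.sqrt (-τ) with hβdef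
  have hβ : MonotoneOn β (Iio 0) := fun τ₁ hτ₁ τ₂ hτ₂ h12 =>
    div_le_div_of_nonneg_left hC (Real.sqrt_pos.2 (neg_pos.2 hτ₂))
      (Real.sqrt_le_sqrt (neg_le_neg h12))
  have hbdd : ∀ k, ∀ τ ∈ Ioo (A k) 0, ∀ x, ‖w k τ x‖ ≤ β τ := fun k τ hτ x => by
    have hs : 0 < Real.sqrt (-τ) := Real.sqrt_pos.2 (neg_pos.2 hτ.2)
    rw [hβdef, le_div_iff₀ hs, mul_comm]
    exact hI k τ hτ x
  obtain ⟨φ, W, hφ, hWc, hWdiv, hWb, hWmild, hunif, hpt, hloc⟩ :=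
    exists_oseenMild_limit_of_monotone_bound hAlim hβ hcont hdiv hmild hbdd
  refine ⟨φ, W, hφ, hWc, hWdiv, fun t ht x => ?_, hWmild, hunif, hpt, hloc⟩
  have hs : 0 < Real.sqrt (-t) := Real.sqrt_pos.2 (neg_pos.2 ht)
  rw [mul_comm, ← le_div_iff₀ hs]
  exact hWb t ht x

end Literature.Analysis.FluidPDE

end
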